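import Summits.Schanuel.Schanuel.Theorems.RootDecomp1BNesterenkoRadical03
import Summits.Schanuel.Schanuel.Theorems.RootDecomp1KFiniteOrderCell02
import Summits.Schanuel.Schanuel.Theorems.RootDecomp1BDefectFloorCellsPi
import Summits.Schanuel.Schanuel.Theorems.RootDecomp1KPiCells
import Literature.Barriers.Schanuel.NesterenkoModularScopeMeasure
import Literature.Barriers.Schanuel.NesterenkoModularScopeValuesProofs
import Literature.NumberTheory.Transcendental.NesterenkoEliminationFacts2
import Literature.NumberTheory.Transcendental.PhilipponCriterionProofs
import Literature.RingTheory.KrullDimension.AffineDimension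
import Mathlib.RingTheory.Ideal.Quotient.Operations
import Literature.Barriers.Schanuel.NesterenkoModularScopeMeasurePolys
import Literature.NumberTheory.Transcendental.NesterenkoEliminationCor410Proofs
import Literature.NumberTheory.Transcendental.PhilipponCriterionHomogenization

/-!
# RootDecomp1BFiniteOrderRadical — lens 4, generation 34 «FINITE-ORDER NESTERENKO STOREY» (X(2) at (π, ρπ) for every ρ of exponential Liouville order 57) — part 1 (RootDecomp1BFiniteOrderRadical01): §A the log-size measure class `LogSizeMeasure`, `qN = e^{−2π}`, the cone-ideal rank `exists_rank_coneIdeal`, the triple `nesterenkoTriple = (q₀, P(q₀), Q(q₀))`, `trdeg_adjoin_qN_le_three`, `algebraicIndependent_nesterenkoTriple (h11)`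

PORT NOTE (census-1 gen 16, 2026-08-31): port of HOME/decomp-schanuel-lens-4/g34/FiniteOrderRadical.lean (sha256 721281aa…4b53, 1388 l;
own farm rc 0 · 0 warn · 0 sorry · axioms std; critic VERDICT STATUS L1761: CHECKLIST B-g34 MET, ONE 1B cell-decision credit to lens-4 g34 under
B-R21 (d); PORT GO LOW `--supports stmt-Schanuel-24622`). Five parts `RootDecomp1BFiniteOrderRadical01`–`05` follow the lens's own PORT NOTE
(NODE.md §5): 01 = §A up to `algebraicIndependent_nesterenkoTriple` (cone ideal rank, the triple, trdeg ≤ 3), 02 = §A the DERIVED measure (31)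
`logSize_ramanujanPoint_of (h51) (h411)` / `logSizeMeasure_nesterenkoPoint` / `logSizeMeasure_nesterenkoTriple_of (h11) (h51) (h411)` + the §B
estimates (`mvPolyHeight_le_mvlen`, `logSize_lower_bound`, `finiteOrder_clash` — moved ahead of the kernel as the lens's note allows), 03 = §B the
kernel `algebraicIndependent_radical_of_logSizeMeasure` (`maxHeartbeats 1600000` as in the source), 04 = §C cells at (π, ρπ)/(ρπ, π) for every
`LiouvilleOrder 57 ρ` mod `hN : LogSizeMeasure 4 24 nesterenkoTriple`, At-cells of 32406/32407/32408, 1K instance shapes (33363/33364 at n = 4),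
05 = §C members `rhoT = towerNumber 58` / `lambdaH`, separation, the flagship ∃-cell and the `_of_facts` re-keyings. FACT FOOTING: the three
registered facts `nesterenko1996_thm_1_1` / `NesterenkoPhilippon2001_ch3_thm_5_1` / `NesterenkoPhilippon2001_ch3_prop_4_11` are ALL tree-PROVED
(`…_holds` in NesterenkoModularScopeHolds / NesterenkoModularScopeMeasureHoldsProofs / NesterenkoEliminationProp411Holds) but those proof modules
answer rc 75 «unbuilt» on the check farm today (critic-confirmed, VERDICT L1761 fallback (4′)), so parts 01–05 keep them as BY-NAME binders exactly
as the lens wrote them; a sixth part `RootDecomp1BFiniteOrderRadical06` plugging the three `_holds` terms (hypothesis-free cells) is filed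
separately and lands when the gate can build that cone. PORT EDITS: `set_option linter.dupNamespace false` dropped, four one-line docstrings
added; statements and proofs verbatim. Nothing here proves Schanuel; rung 0. The lens's header follows.
-/

/-!
# RootDecomp1B · lens 4 (minimal-counterexample / extremal reduction) · generation 34 —
# «THE FINITE-ORDER NESTERENKO STOREY»: `t(π, ρπ) ≥ 4` for every real `ρ` of exponential Liouville order `57`

Route `route-Schanuel-RootDecomp1B` (DRAFT rev 32), live target
X = `Summit.Schanuel.Schanuel.Theses.RootDecomp1B.KleinPolarSchanuel` (stmt-Schanuel-24622):
«every ℚ-free real `m`-tuple `r` has polar degree `t(r) = trdeg ℚ(r, ir, e^r, e^{ir}) ≥ 2m`».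

## What this file proves (0 `sorry`, standard axioms)

X(2) — the literal `m = 2` body of X — at the storey-two tuples `r = (π, ρπ)` and `(ρπ, π)` for EVERY real `ρ` of
exponential Liouville order `57` (`LiouvilleOrder 57 ρ`: `|ρ − a/q| < exp(−q⁵⁷)` for infinitely many `q`; tree,
route 1K), hence for every hyper-Liouville and every ultra-Liouville `ρ` (g33's class, whose input Cor. 5.2 is here
REMOVED) and at the NAMED non-hyper-Liouville member `ρ_T = towerNumber 58` (tree) — together with the route's step
cells `TameDefectZeroAt 1 (ρπ | π)`, `SharpRelativeLindemannAt 1`, `WildSharpDefectZeroAt 1`, `WildSharpDefectZeroInitAt 1`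
at these tuples and the `n = 4` instances of route 1K's items 33363 / 33364 at `z = (π, ρπ, iπ, iρπ)`.

* §A THE MEASURE, DERIVED.  `LogSizeMeasure a b θ`: `exp(−κ t^a (log t)^b) ≤ |P(θ)|` for all non-zero integer `P`
  and `t ≥ max(deg P + log H(P), e)`.  MAIN: `logSize_ramanujanPoint_of` = inequality (31) of LNM 1752 Ch. 3 p. 47
  (`exp(−c T⁴ log²⁴ T) ≤ |B(q, P(q), Q(q), R(q))|` for `B(ω) ≠ 0`), DERIVED along the printed proof of Cor. 5.2 from
  Theorem 5.1 + Proposition 4.11 + Corollary 4.10 + homogenisation; then `logSizeMeasure_nesterenkoTriple_of`: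
  `LogSizeMeasure 4 24 (q₀, P(q₀), Q(q₀))`, `q₀ = e^{−2π}` (`R(q₀) = 0`, `P(q₀) = 3/π`: tree, PROVED).
  INPUTS BY NAME (critic checklist B-g34 (4′)): `h11 : nesterenko1996_thm_1_1`, `h51 : NesterenkoPhilippon2001_ch3_thm_5_1`,
  `h411 : NesterenkoPhilippon2001_ch3_prop_4_11` — registered Literature facts, all three PROVED in the tree
  (`nesterenko1996_thm_1_1_holds`, `NesterenkoPhilippon2001_ch3_thm_5_1_holds`, `NesterenkoPhilippon2001_ch3_prop_4_11_holds`);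
  they enter as binders ONLY because the farm snapshot of 2026-08-31 has their proof modules unbuilt
  (`remote:stale … unbuilt:Literature.NumberTheory.Transcendental.NesterenkoDegreeCut / …Prop411Holds /
  …NesterenkoModularScopeMeasureProofs`).  Corollary 4.10 is consumed PROVED (`NesterenkoPhilippon2001_ch3_cor_4_10_holds`).
  NOT derived: the registered `Literature.Barriers.Schanuel.NesterenkoPhilippon2001_ch3_cor_5_2` in full — its transfer
  from `ω̄ = (q, P, Q, R)` to an arbitrary `ξ` over which `q, P, Q, R` are algebraic (the norm step of p. 47) is the
  clause not reached; this storey does not need it, because the kernel runs at the triple `(q₀, P(q₀), Q(q₀))` itself.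
* §B THE KERNEL at FINITE order.  `algebraicIndependent_radical_of_logSizeMeasure`: if `LogSizeMeasure a b θ`, `1 ≤ a`,
  `e^{y₀} = θ_{i₀}`, and `ρ > 0` has `LiouvilleOrder m ρ` with `m ≥ 2(a + b) + 1`, then `e^{ρ y₀}, ρ, θ` are algebraically
  independent.  Same radical-conjugate descent as the tree kernel `RootDecomp1BNesterenkoRadical02` (norm over the
  conjugates `ζ e^{a y₀/q}`), but the clash is now POLYNOMIAL: lower bound `exp(−c_M q^{2(a+b)})` (the log-size of the
  descended norm polynomial is `O(q²)`) against the upper bound `exp(c_U q²)·exp(−q^m)`; `m = 2(a+b)+1` wins.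
  For `(a, b) = (4, 24)`: `m = 57`.
* §C THE CELLS (one hypothesis `hN : LogSizeMeasure 4 24 nesterenkoTriple`, = §A's output; `_of_facts` versions carry
  the three named facts instead): `four_le_polarDeg_pi` / `_smul_pi_pi` (X(2) at `(π, ρπ)`, `(ρπ, π)`, order 57, both
  signs of `ρ` via `ρ ↦ −ρ`), `kleinPolarSchanuel_body_two_pi` (X's verbatim body, `m = 2`), the At-cells of items
  32406 / 32407 / 32408, the 1K instances (33363 hyper class: `four_le_polarDeg_pi_hyper`; 33364 finite-order class),
  `four_le_polarDeg_pi_ultra` (g33's cell WITHOUT `h52`), the named members `ρ_T = towerNumber 58`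
  (`liouvilleOrder_towerNumber 57`, `not_hyperLiouville_towerNumber`: order 57, NOT hyper-, NOT ultra-Liouville) and
  `λ_H` (`hyperLiouville_lambdaH`), X APPLIED at both (`kleinPolarSchanuel_instance_pi_rhoT / _lambdaH`), and the
  separation of `(π, ρ_T π)` from every earlier storey-two cell (`(1 | u)`, `(π, uπ)` with `u` ultra/hyper, algebraic
  E-lines) — hypothesis-free.

## Label
Engine class: VARIANT-REACH of g33 (same descent kernel); the delta is (i) the DERIVATION of the log-size measure (31)
inside the tree's Chapter-3 formalisation (no Cor. 5.2 hypothesis) and (ii) the finite-order reach `LiouvilleOrder 57`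
(still Lebesgue-null and of Hausdorff dimension 0, but a dense `G_δ` class defined by ONE exponential rate,
strictly containing the hyper- and ultra-Liouville reals, with named NON-hyper members such as `towerNumber 58`),
which g33's `exp(−exp)`-clash could not touch.

## Port note
Tree port = this file split in three (§A / §B / §C) under `Summits/Schanuel/Schanuel/Theorems/RootDecomp1BFiniteOrderRadical0k.lean`;
once the farm has `NesterenkoModularScopeMeasureHoldsProofs`, `NesterenkoEliminationProp411Holds`, `NesterenkoModularScopeHolds`
built, a fourth 10-line part discharges `hN` by
`logSizeMeasure_nesterenkoTriple_of nesterenko1996_thm_1_1_holds NesterenkoPhilippon2001_ch3_thm_5_1_holds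
NesterenkoPhilippon2001_ch3_prop_4_11_holds` and restates every §C cell hypothesis-free.
-/

noncomputable section

open Complex

namespace Summit.Schanuel.Schanuel.Theorems.RootDecomp1BFiniteOrderRadical

/-! ## §A  The log-size measure (31) of LNM 1752 Ch. 3 p. 47 at Nesterenko's point, DERIVED from the tree's
Theorem 5.1, Proposition 4.11 and Corollary 4.10 -/

section Measure

open MvPolynomial IntermediateField
open Literature.NumberTheory.Transcendental (mvPolyHeight)
open Literature.NumberTheory.Transcendental.PhilipponMain (one_le_mvPolyHeight mem_coneIdeal_iff_of_isHomogeneous)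
open Literature.NumberTheory.Transcendental.Nesterenko
open Literature.Barriers.Schanuel

attribute [local instance] MvPolynomial.gradedAlgebra

variable {n : ℕ}

/-- **`LogSizeMeasure a b θ`** — a measure of algebraic independence of the tuple `θ` that is POLYNOMIAL IN THE
LOG-SIZE `t = deg P + log H(P)` (`H` = maximum modulus of the coefficients), hence log-polynomial in the height at
fixed degree and uniform in the degree: `exp(−κ t^a (log t)^b) ≤ ‖P(θ)‖` for every non-zero integer `P` and every
`t ≥ max(deg P + log H(P), e)`. -/
def LogSizeMeasure (a b : ℕ) (θ : Fin n → ℂ) : Prop :=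
  ∃ κ : ℝ, 0 < κ ∧ ∀ P : MvPolynomial (Fin n) ℤ, P ≠ 0 → ∀ t : ℝ,
    max ((P.totalDegree : ℝ) + Real.log (mvPolyHeight P)) (Real.exp 1) ≤ t →
      Real.exp (-(κ * t ^ a * Real.log t ^ b)) ≤ ‖MvPolynomial.aeval θ P‖

/-- Nesterenko's nome `q₀ = e^{−2π}`. -/
def qN : ℂ := ((Real.exp (-(2 * Real.pi)) : ℝ) : ℂ)

/-- `0 < |q₀|`. -/
theorem norm_qN_pos : 0 < ‖qN‖ := by
  rw [qN, Complex.norm_real, Real.norm_eq_abs, abs_of_pos (Real.exp_pos _)]; exact Real.exp_pos _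

/-- `|q₀| < 1`. -/
theorem norm_qN_lt_one : ‖qN‖ < 1 := by
  rw [qN, Complex.norm_real, Real.norm_eq_abs, abs_of_pos (Real.exp_pos _)]
  exact Real.exp_lt_one_iff.mpr (by linarith [Real.pi_pos])

/-- **The dimension count at a point with `trdeg_ℚ ℚ(q, P(q), Q(q), R(q)) ≤ 3`**: `r = dim ℚ[x₀, …, x₄]/𝔭_ω̄`
satisfies `1 ≤ r ≤ 4` (the tree's `ringKrullDim_quotient_coneIdeal_le` is the case `trdeg ≤ 2 ⇒ r ≤ 3`; same
proof: `ℚ[x̲]/𝔭 ↪ K₀[t]`). -/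
private theorem omega_mem_adjoin (q : ℂ) (i : Fin 5) :
    nesterenkoOmega q i ∈ adjoin ℚ ({q, ramanujanP q, ramanujanQ q, ramanujanR q} : Set ℂ) := by
  fin_cases i
  · exact (adjoin ℚ _).one_mem
  all_goals
    apply IntermediateField.subset_adjoin
    simp [nesterenkoOmega]

/-- The cone ideal of `ω̄ = (1, q, P(q), Q(q), R(q))` is unmixed of some rank `1 ≤ r ≤ 4` (from `trdeg ≤ 3` via the Krull dimension). -/
theorem exists_rank_coneIdeal (q : ℂ)
    (hK : Algebra.trdeg ℚ ↥(adjoin ℚ ({q, ramanujanP q, ramanujanQ q, ramanujanR q} : Set ℂ)) ≤ 3) :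
    ∃ r : ℕ, 1 ≤ r ∧ r ≤ 4 ∧
      ringKrullDim (Rx 4 ⧸ coneIdeal (nesterenkoOmega q)) = r := by
  set K₀ := adjoin ℚ ({q, ramanujanP q, ramanujanQ q, ramanujanR q} : Set ℂ) with hK₀
  set ω := nesterenkoOmega q with hω
  set 𝔭 : Ideal (Rx 4) := coneIdeal ω with h𝔭
  haveI h𝔭p : 𝔭.IsPrime := isPrime_coneIdeal ω
  -- the substitution `xᵢ ↦ ωᵢ t` with values in `K₀[t]`
  let ω' : Fin 5 → K₀ := fun i => ⟨ω i, omega_mem_adjoin q i⟩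
  let φ₀ : Rx 4 →ₐ[ℚ] Polynomial K₀ :=
    aeval fun i : Fin 5 => Polynomial.C (ω' i) * Polynomial.X
  let ι : Polynomial K₀ →ₐ[ℚ] Polynomial ℂ := (Polynomial.mapAlg K₀ ℂ).restrictScalars ℚ
  have hιmap : ∀ f, ι f = Polynomial.map (algebraMap K₀ ℂ) f := fun f => by
    simp [ι, Polynomial.mapAlg_eq_map]
  have hι : Function.Injective ι := fun f g hfg => by
    rw [hιmap, hιmap] at hfg
    exact Polynomial.map_injective _ (algebraMap K₀ ℂ).injective hfg
  have hcomp : (ι.comp φ₀ : Rx 4 →ₐ[ℚ] Polynomial ℂ) =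
      aeval fun i : Fin 5 => Polynomial.C (ω i) * Polynomial.X := by
    refine MvPolynomial.algHom_ext fun i => ?_
    rw [AlgHom.comp_apply, hιmap]
    simp [φ₀, ω']
  have hker : RingHom.ker φ₀ = 𝔭 := by
    rw [h𝔭, coneIdeal, ← hcomp]
    ext P
    simp only [RingHom.mem_ker, AlgHom.coe_comp, Function.comp_apply]
    rw [← map_zero ι]
    exact hι.eq_iff.symm
  -- `A = ℚ[x̲]/𝔭` is an affine domain over `ℚ`
  haveI : IsDomain (Rx 4 ⧸ 𝔭) := Ideal.Quotient.isDomain 𝔭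
  haveI : Algebra.FiniteType ℚ (Rx 4 ⧸ 𝔭) :=
    Algebra.FiniteType.of_surjective (Ideal.Quotient.mkₐ ℚ 𝔭) (Ideal.Quotient.mkₐ_surjective ℚ 𝔭)
  have hdim := Literature.RingTheory.KrullDimension.ringKrullDim_eq_trdeg ℚ (Rx 4 ⧸ 𝔭)
  have hfin : Algebra.trdeg ℚ (Rx 4 ⧸ 𝔭) < Cardinal.aleph0 :=
    trdeg_lt_aleph0 (R := ℚ) (S := Rx 4 ⧸ 𝔭)
  -- the injection `A ↪ K₀[t]`
  have h0 : ∀ a : Rx 4, a ∈ 𝔭 → φ₀ a = 0 := fun a ha => by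
    rwa [← hker, RingHom.mem_ker] at ha
  let ψ : (Rx 4 ⧸ 𝔭) →ₐ[ℚ] Polynomial K₀ := Ideal.Quotient.liftₐ 𝔭 φ₀ h0
  have hψ : Function.Injective ψ := by
    have e : ⇑ψ = ⇑(Ideal.Quotient.lift 𝔭 (φ₀ : Rx 4 →+* Polynomial K₀) h0) :=
      funext fun x => Ideal.Quotient.liftₐ_apply 𝔭 φ₀ h0 x
    rw [e]
    exact RingHom.lift_injective_of_ker_le_ideal 𝔭 h0 hker.le
  -- upper bound: `trdeg_ℚ A ≤ trdeg_ℚ K₀[t] = trdeg_ℚ K₀ + 1 ≤ 4`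
  have hup : Algebra.trdeg ℚ (Rx 4 ⧸ 𝔭) ≤ 4 := by
    refine (trdeg_le_of_injective ψ hψ).trans ?_
    haveI : FaithfulSMul ℚ K₀ :=
      (faithfulSMul_iff_algebraMap_injective ℚ K₀).mpr (algebraMap ℚ K₀).injective
    rw [← trdeg_add_eq ℚ K₀ (A := Polynomial K₀), Polynomial.trdeg_of_isDomain]
    have : (4 : Cardinal) = 3 + 1 := by norm_num
    rw [this]
    gcongr
  -- lower bound: `x₀ ↦ t` is transcendental, so `trdeg_ℚ A ≥ 1`
  have hlow : 1 ≤ Algebra.trdeg ℚ (Rx 4 ⧸ 𝔭) := by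
    have hω'0 : ω' 0 = 1 := Subtype.ext (by simp [ω', hω])
    have ht : Transcendental ℚ (Ideal.Quotient.mk 𝔭 (X 0) : Rx 4 ⧸ 𝔭) := by
      rintro ⟨p, hp0, hp⟩
      apply hp0
      have h1 : Polynomial.aeval (X 0 : Rx 4) p ∈ 𝔭 := by
        rw [← Ideal.Quotient.eq_zero_iff_mem, ← Ideal.Quotient.mkₐ_eq_mk ℚ,
          ← Polynomial.aeval_algHom_apply]
        exact hp
      rw [← hker, RingHom.mem_ker, ← Polynomial.aeval_algHom_apply] at h1
      have h2 : φ₀ (X 0) = Polynomial.X := by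
        simp [φ₀, hω'0]
      rw [h2, ← Polynomial.aeval_map_algebraMap K₀ Polynomial.X p,
        Polynomial.aeval_X_left_apply,
        Polynomial.map_eq_zero_iff (algebraMap ℚ K₀).injective] at h1
      exact h1
    haveI : Algebra.Transcendental ℚ (Rx 4 ⧸ 𝔭) := ⟨⟨_, ht⟩⟩
    exact Cardinal.one_le_iff_pos.mpr (trdeg_pos ℚ (Rx 4 ⧸ 𝔭))
  -- read off the natural number
  obtain ⟨n, hn⟩ := Cardinal.lt_aleph0.mp hfin
  refine ⟨n, ?_, ?_, ?_⟩
  · rw [hn] at hlow; exact_mod_cast hlow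
  · rw [hn] at hup; exact_mod_cast hup
  · rw [hdim, hn, Cardinal.toNat_natCast]

/-- **Nesterenko's triple** `(q₀, P(q₀), Q(q₀))`, `q₀ = e^{−2π}` — the three algebraically independent numbers
of LNM 1752 Ch. 3 Thm 1.1 at `τ = i` (`R(q₀) = 0`); `P(q₀) = 3/π`, `Q(q₀) = 3Γ(1/4)⁸/(2π)⁶`. -/
def nesterenkoTriple : Fin 3 → ℂ := ![qN, ramanujanP qN, ramanujanQ qN]

/-- Coordinate `0` of the triple is `q₀`. -/
@[simp] theorem nesterenkoTriple_zero : nesterenkoTriple 0 = qN := rfl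
/-- Coordinate `1` of the triple is `P(q₀)`. -/
@[simp] theorem nesterenkoTriple_one : nesterenkoTriple 1 = ramanujanP qN := rfl
/-- Coordinate `2` of the triple is `Q(q₀)`. -/
@[simp] theorem nesterenkoTriple_two : nesterenkoTriple 2 = ramanujanQ qN := rfl

/-- `R(q₀) = 0` (tree, PROVED: `E₆(i) = 0`). -/
theorem ramanujanR_qN : ramanujanR qN = 0 := ramanujan_values_exp_neg_two_pi_holds.2.2

/-- `P(q₀) = 3/π` (tree, PROVED: `E₂(i) = 3/π`). -/
theorem ramanujanP_qN : ramanujanP qN = 3 / (Real.pi : ℂ) := ramanujan_values_exp_neg_two_pi_holds.1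

/-- `ℚ(q₀, P(q₀), Q(q₀), R(q₀)) ⊆ ℚ(q₀, P(q₀), Q(q₀))` since `R(q₀) = 0`. -/
theorem adjoin_four_le_adjoin_nesterenkoTriple :
    adjoin ℚ ({qN, ramanujanP qN, ramanujanQ qN, ramanujanR qN} : Set ℂ) ≤
      adjoin ℚ (Set.range nesterenkoTriple) := by
  refine adjoin_le_iff.mpr ?_
  intro x hx
  simp only [Set.mem_insert_iff, Set.mem_singleton_iff] at hx
  rcases hx with rfl | rfl | rfl | rfl
  · exact subset_adjoin ℚ _ ⟨0, rfl⟩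
  · exact subset_adjoin ℚ _ ⟨1, rfl⟩
  · exact subset_adjoin ℚ _ ⟨2, rfl⟩
  · rw [ramanujanR_qN]; exact zero_mem _

/-- `(q₀, P(q₀), Q(q₀), R(q₀)) = ramanujanPoint q₀` generates a field inside `ℚ(nesterenkoTriple)`. -/
theorem adjoin_ramanujanPoint_le_adjoin_nesterenkoTriple :
    adjoin ℚ (Set.range (ramanujanPoint qN)) ≤ adjoin ℚ (Set.range nesterenkoTriple) := by
  rw [range_ramanujanPoint]; exact adjoin_four_le_adjoin_nesterenkoTriple

/-- At Nesterenko's nome `trdeg_ℚ ℚ(q₀, P(q₀), Q(q₀), R(q₀)) ≤ 3` — ELEMENTARY from `R(q₀) = 0` (three generators). -/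
theorem trdeg_adjoin_qN_le_three :
    Algebra.trdeg ℚ ↥(adjoin ℚ ({qN, ramanujanP qN, ramanujanQ qN, ramanujanR qN} : Set ℂ)) ≤ 3 := by
  have hle := adjoin_four_le_adjoin_nesterenkoTriple
  refine (trdeg_le_of_injective (inclusion hle) (inclusion_injective hle)).trans ?_
  exact_mod_cast Literature.NumberTheory.Transcendental.Philippon1986_criterion.trdeg_adjoin_range_le nesterenkoTriple

/-- `l : Fin n → E` generating a field of transcendence degree `≥ n` is algebraically independent (copy of the
tree's `Literature.Barriers.Schanuel.algebraicIndependent_of_le_trdeg_adjoin`, whose module is outside this file's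
import cone). -/
private theorem algebraicIndependent_of_le_trdeg_adjoin' {K E : Type*} [Field K] [Field E] [Algebra K E]
    {n : ℕ} (l : Fin n → E) (h : (n : Cardinal) ≤ Algebra.trdeg K (adjoin K (Set.range l))) :
    AlgebraicIndependent K l := by
  set A : IntermediateField K E := adjoin K (Set.range l) with hA
  let x : Fin n → A := fun i => ⟨l i, subset_adjoin K _ ⟨i, rfl⟩⟩
  haveI : Algebra.IsAlgebraic (Algebra.adjoin K (Set.range x)) A := by
    have hx : Set.range x = ((↑) : A → E) ⁻¹' Set.range l := by
      ext a
      constructor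
      · rintro ⟨i, rfl⟩; exact ⟨i, rfl⟩
      · rintro ⟨i, hi⟩; exact ⟨i, Subtype.ext hi⟩
    rw [hx]
    exact Literature.NumberTheory.Transcendental.isAlgebraic_adjoin_over_algebraAdjoin _
  have hB := Algebra.IsAlgebraic.isTranscendenceBasis_of_lift_le_trdeg_of_finite K x
    (by simpa using h)
  exact hB.1.map' (f := A.val) (fun a b hab => Subtype.ext hab)

/-- **Nesterenko's theorem** (LNM 1752 Ch. 3 Thm 1.1, registered fact `nesterenko1996_thm_1_1`, PROVED in the tree as
`nesterenko1996_thm_1_1_holds`) ⟹ `q₀, P(q₀), Q(q₀)` are algebraically independent. -/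
theorem algebraicIndependent_nesterenkoTriple (h11 : nesterenko1996_thm_1_1) :
    AlgebraicIndependent ℚ nesterenkoTriple := by
  refine algebraicIndependent_of_le_trdeg_adjoin' _ ?_
  have h3 := h11 qN norm_qN_pos norm_qN_lt_one
  have hle := adjoin_four_le_adjoin_nesterenkoTriple
  have := h3.trans (trdeg_le_of_injective (inclusion hle) (inclusion_injective hle))
  exact_mod_cast this

end Measure

end Summit.Schanuel.Schanuel.Theorems.RootDecomp1BFiniteOrderRadical

end
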